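import Mathlib
import HarnessLib
import Summits.ResolutionOfSingularities.ResolutionOfSingularities.Theorems.WildQuotientsWildQuotientResolutionToricExitTransfer
import Summits.ResolutionOfSingularities.ResolutionOfSingularities.Theorems.WildQuotientsWildQuotientResolutionBlowupLocalExitQuotient
import Summits.ResolutionOfSingularities.ResolutionOfSingularities.Theorems.WildQuotientsWildQuotientResolutionBlowupLocalExitClosedThree

/-!
# The toric exit transfer with THREE pieces: two cone pieces and one terminal piece
(crux stmt-ResolutionOfSingularities-15640 `WildQuotients.WildQuotientResolution`, line `Sketch`;
chain w45c programme V4U (`L/w45c/CHAIN.md` v6 §4 lead-1 row «V4U-F», `L/w45c/V4U-DESIGN.md` §5);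
[OURS · L1 W4.5c] — NOT a statement of any manuscript; replaces the role of no printed item.)

`ToricExit.toricExitTransfer₃` is the three-piece analogue of `ToricExit.toricExitTransfer`
(p487969), i.e. the hypothesis-composed skeleton of the V4U final `jordanFour_hasResolution`
(every `p ≥ 5`). Data: crux data `(X', X₁, f, q, G, ρ)` with `|G| = p`, `ρ` faithful, `X₁` AFFINE
integral of finite type and of positive dimension, `q` finite surjective with orbit fibres and
generically étale; an equivariant proper birational integral model `π : V → X'` with action `ρB`
over `X₁`; THREE `G`-stable opens `O₀, O₁, O₂` of `V`, affine over `X₁`, covering `V`, with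

* piece `2` Király–Lütkebohmert terminal: `O₂` non-empty and regular, and the stalk augmentation
  ideal principal at every fixed point of `O₂` — so `O₂/G` is regular
  (`ToricExit.isRegular_pieceQuot_of_stalkAug`, p487969);
* pieces `0` and `1` each carrying a closed `Tᵢ ⊆ Oᵢ` (the vertex curves) missing the two other
  opens, such that SOME blow-up of the quotient piece `Oᵢ/G` along the ideal sheaf of the (closed)
  image of `Tᵢ` is regular (in V4U: `O₀/G ≅ ⅓(1,1,2)-cone × 𝔸`, `O₁/G ≅ (½(1,1,1)-cone × 𝔸)_Q`,
  `Tᵢ` = the vertex curves `C₀`, `C₁`; V4U-DESIGN §2–§3).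

Conclusion: `X₁` has a resolution of singularities — the glued quotient `Y = V/G` (Q1, p479608) is
blown up along the ideal sheaf of `π(T₀) ∪ π(T₁)` (`BlowupExit.hasResolution_glued_of_three_pieces`,
p492084, with the centre from `BlowupExit.exists_closeds_image_gluedMk₃`, p492946), and resolutions
transfer along the proper birational `Y → X₁` (`QuotientModel.hasResolution_of_hasResolution_glued`).
-/

-- single-problem summit: the doubled namespace component `ResolutionOfSingularities` is forced
set_option linter.dupNamespace false

noncomputable section

open CategoryTheory AlgebraicGeometry TopologicalSpace
open Literature.AlgebraicGeometry.Resolution Literature.AlgebraicGeometry.RelativeSpec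
open Literature.AlgebraicGeometry.CossartPiltant200819

namespace Summit.ResolutionOfSingularities.ResolutionOfSingularities.Theorems.WildQuotientResolution.ToricExit

/-- The preimage in the chart `O/G ↪ X/G` of the image `π(T)` of a subset `T ⊆ O` is the image of
`T ∩ O` under `O → O/G`. [folklore] -/
theorem preimage_gluedι_image_gluedMk_eq {X S : Scheme.{0}} {r : X ⟶ S} {G : Type} [Group G]
    [Finite G] (ρ : ActionOver r G) [S.IsSeparated] [IsSeparated r]
    (hcov : ∀ x : X, ∃ O : ρ.StableAffineOpens, x ∈ O.1) (O : ρ.StableAffineOpens)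
    (T : Set X) (hT : T ⊆ ((O.1 : X.Opens) : Set X)) :
    (ρ.gluedι O).base ⁻¹' ((ρ.gluedMk hcov).base '' T) = (ρ.pieceMk O).base '' (O.1.ι.base ⁻¹' T) := by
  ext y
  simp only [Set.mem_preimage, Set.mem_image]
  constructor
  · rintro ⟨t, ht, hty⟩
    refine ⟨⟨t, hT ht⟩, ht, ?_⟩
    apply (ρ.gluedι O).isOpenEmbedding.injective
    rw [← hty]
    exact (ρ.gluedMk_apply hcov O ⟨t, hT ht⟩).symm
  · rintro ⟨x, hx, rfl⟩
    exact ⟨x.1, hx, ρ.gluedMk_apply hcov O x⟩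

/-- If `π(T)` misses the chart `O/G`, its preimage in `O/G` is empty. [folklore] -/
theorem preimage_gluedι_eq_empty_of_disjoint {X S : Scheme.{0}} {r : X ⟶ S} {G : Type} [Group G]
    [Finite G] (ρ : ActionOver r G) [S.IsSeparated] [IsSeparated r]
    (O : ρ.StableAffineOpens) (Z : Set ρ.glued)
    (hZ : Disjoint (Set.range (ρ.gluedι O).base) Z) :
    (ρ.gluedι O).base ⁻¹' Z = ∅ := by
  ext y
  simp only [Set.mem_preimage, Set.mem_empty_iff_false, iff_false]
  exact fun hy => Set.disjoint_left.mp hZ (Set.mem_range_self y) hy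

-- the glued-quotient / blow-up bookkeeping is individually cheap but numerous
set_option maxHeartbeats 800000 in
/-- **The toric exit transfer, three pieces.** Let `(X', X₁, f, q, G, ρ)` be crux data with
`|G| = p`, `ρ` faithful, `X₁` affine, integral, of finite type over `k` and of positive dimension,
`q` finite surjective with orbit fibres and étale over a dense open; `π : V → X'` an equivariant
proper birational integral model with action `ρB` over `X₁`; `O₀, O₁, O₂` three `G`-stable opens
of `V`, affine over `X₁`, with `O₀ ∪ O₁ ∪ O₂ = V`; `O₂` non-empty, regular, with principal stalk
augmentation ideals at its fixed points; `T₀ ⊆ O₀`, `T₁ ⊆ O₁` closed in `V`, each disjoint from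
the two other opens, such that for `i = 0, 1` some blow-up of the quotient piece `Oᵢ/G` along the
ideal sheaf of the image of `Tᵢ` is regular. Then `X₁` has a resolution of singularities.
[OURS · L1 W4.5c] [folklore; assembly of landed decls] -/
theorem toricExitTransfer₃ (p : ℕ) (hp : p.Prime) (k : Type) [Field k]
    (X' X₁ : Scheme.{0}) (f : X₁ ⟶ Spec (.of k)) (q : X' ⟶ X₁) (G : Type) [Group G] [Finite G]
    (ρ : G →* Aut X') (hcard : Nat.card G = p) (hfaith : Function.Injective ρ)
    [IsAffine X₁] [LocallyOfFiniteType f] [IsIntegral X₁] [IsIntegral X']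
    [IsFinite q] (hdim : ¬ topologicalKrullDim X₁ ≤ 0) (hsurj : Function.Surjective q.base)
    (hU : ∃ U : X₁.Opens, Dense (U : Set X₁) ∧ Etale (q ∣_ U))
    (horb : ∀ x y : X', q.base x = q.base y → ∃ g : G, (ρ g).hom.base x = y)
    (V : Scheme.{0}) (π : V ⟶ X') [IsProper π] (hbir : IsBirational π) [IsIntegral V]
    (ρB : ActionOver (π ≫ q) G)
    (hequiv : ∀ g : G, (ρB.aut g).hom ≫ π = π ≫ (ρ g).hom)
    (O₀ O₁ O₂ : ρB.StableAffineOpens) (hcov₃ : O₀.1 ⊔ O₁.1 ⊔ O₂.1 = ⊤)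
    (hO₂ne : ((O₂.1 : V.Opens) : Set V).Nonempty)
    (hreg₂ : Scheme.IsRegular (O₂.1 : Scheme.{0}))
    (hdiv₂ : ∀ (g : G) (v : V) (hv : (ρB.aut g).hom.base v = v), v ∈ (O₂.1 : V.Opens) →
      (Ideal.span (Set.range fun s : V.presheaf.stalk v =>
        (V.presheaf.stalkSpecializes (specializes_of_eq hv) ≫ (ρB.aut g).hom.stalkMap v).hom s -
          s)).IsPrincipal)
    (T₀ T₁ : Set V) (hT₀ : IsClosed T₀) (hT₁ : IsClosed T₁)
    (h₀₀ : T₀ ⊆ ((O₀.1 : V.Opens) : Set V)) (h₀₁ : Disjoint T₀ ((O₁.1 : V.Opens) : Set V))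
    (h₀₂ : Disjoint T₀ ((O₂.1 : V.Opens) : Set V))
    (h₁₁ : T₁ ⊆ ((O₁.1 : V.Opens) : Set V)) (h₁₀ : Disjoint T₁ ((O₀.1 : V.Opens) : Set V))
    (h₁₂ : Disjoint T₁ ((O₂.1 : V.Opens) : Set V))
    (hP₀ : ∀ (Z₀ : Closeds (ρB.pieceQuot O₀)),
      (Z₀ : Set (ρB.pieceQuot O₀)) = (ρB.pieceMk O₀).base '' (O₀.1.ι.base ⁻¹' T₀) →
      ∃ (B : Scheme.{0}) (pB : B ⟶ ρB.pieceQuot O₀),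
        IsBlowup pB (Scheme.IdealSheafData.vanishingIdeal Z₀) ∧ Scheme.IsRegular B)
    (hP₁ : ∀ (Z₁ : Closeds (ρB.pieceQuot O₁)),
      (Z₁ : Set (ρB.pieceQuot O₁)) = (ρB.pieceMk O₁).base '' (O₁.1.ι.base ⁻¹' T₁) →
      ∃ (B : Scheme.{0}) (pB : B ⟶ ρB.pieceQuot O₁),
        IsBlowup pB (Scheme.IdealSheafData.vanishingIdeal Z₁) ∧ Scheme.IsRegular B) :
    Scheme.HasResolution X₁ := by
  classical
  -- separatedness and noetherianity
  haveI : X₁.IsSeparated := inferInstance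
  haveI : X'.IsSeparated := ⟨by rw [← Limits.terminal.comp_from q]; infer_instance⟩
  haveI : IsLocallyNoetherian X₁ := LocallyOfFiniteType.isLocallyNoetherian f
  -- the cover by `G`-stable opens affine over `X₁`
  have hcov : ∀ v : V, ∃ O : ρB.StableAffineOpens, v ∈ O.1 := by
    intro v
    have hv : v ∈ O₀.1 ⊔ O₁.1 ⊔ O₂.1 := by rw [hcov₃]; exact Opens.mem_top v
    rcases Opens.mem_sup.mp hv with h | h
    · rcases Opens.mem_sup.mp h with h' | h'
      · exact ⟨O₀, h'⟩
      · exact ⟨O₁, h'⟩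
    · exact ⟨O₂, h⟩
  -- `Y = V/G`: integral, proper and birational over `X₁`
  obtain ⟨hY, hr, hrbir⟩ := QuotientModel.quotientModel_proper_birational k X' X₁ f q G ρ hfaith
    hdim hsurj hU horb V π hbir ρB hequiv hcov
  haveI := hY
  haveI : IsLocallyNoetherian ρB.glued :=
    LocallyOfFiniteType.isLocallyNoetherian (ρB.gluedDesc (π ≫ q) ρB.aut_comp ≫ f)
  -- piece `2` is regular
  have hQ : Scheme.IsRegular (ρB.pieceQuot O₂) :=
    isRegular_pieceQuot_of_stalkAug ρB hp hcard O₂ hO₂ne hreg₂ hdiv₂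
  -- the centre: `Z = π(T₀) ∪ π(T₁)`, each part missing the two other charts
  obtain ⟨Z₀, hZ₀, hZ₀₁, hZ₀₂⟩ :=
    BlowupExit.exists_closeds_image_gluedMk₃ ρB hcov O₀ O₁ O₂ hcov₃ T₀ hT₀ h₀₀ h₀₁ h₀₂
  have hcov₃' : O₁.1 ⊔ O₀.1 ⊔ O₂.1 = ⊤ := by rw [sup_comm O₁.1, hcov₃]
  obtain ⟨Z₁, hZ₁, hZ₁₀, hZ₁₂⟩ :=
    BlowupExit.exists_closeds_image_gluedMk₃ ρB hcov O₁ O₀ O₂ hcov₃' T₁ hT₁ h₁₁ h₁₀ h₁₂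
  let Z : Closeds ρB.glued := Z₀ ⊔ Z₁
  have hZcoe : (Z : Set ρB.glued) = (ρB.gluedMk hcov).base '' T₀ ∪ (ρB.gluedMk hcov).base '' T₁ := by
    change ((Z₀ ⊔ Z₁ : Closeds ρB.glued) : Set ρB.glued) = _
    rw [Closeds.coe_sup, hZ₀, hZ₁]
  have hZ₂ : Disjoint (Set.range (ρB.gluedι O₂).base) (Z : Set ρB.glued) := by
    rw [hZcoe]
    exact Disjoint.union_right (hZ₀ ▸ hZ₀₂) (hZ₁ ▸ hZ₁₂)
  -- `Z ≠ univ`: the non-empty chart `O₂/G` misses `Z`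
  have hZ : (Z : Set ρB.glued) ≠ Set.univ := by
    obtain ⟨v, hv⟩ := hO₂ne
    intro huniv
    have hmem : (ρB.gluedMk hcov).base v ∈ (Z : Set ρB.glued) := by rw [huniv]; trivial
    have hrange : (ρB.gluedMk hcov).base v ∈ Set.range (ρB.gluedι O₂).base := by
      have h : v ∈ ρB.gluedMk hcov ⁻¹ᵁ (ρB.gluedι O₂).opensRange := by
        rw [ρB.preimage_opensRange_gluedι hcov O₂]
        exact hv
      exact h
    exact Set.disjoint_left.mp hZ₂ hrange hmem
  -- the preimages of `Z` in the charts `O₀/G`, `O₁/G`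
  have hZpre₀ : ((Z.preimage (ρB.gluedι O₀).continuous : Closeds (ρB.pieceQuot O₀)) :
      Set (ρB.pieceQuot O₀)) = (ρB.pieceMk O₀).base '' (O₀.1.ι.base ⁻¹' T₀) := by
    rw [Closeds.coe_preimage, hZcoe, Set.preimage_union,
      preimage_gluedι_image_gluedMk_eq ρB hcov O₀ T₀ h₀₀,
      preimage_gluedι_eq_empty_of_disjoint ρB O₀ _ (hZ₁ ▸ hZ₁₀), Set.union_empty]
  have hZpre₁ : ((Z.preimage (ρB.gluedι O₁).continuous : Closeds (ρB.pieceQuot O₁)) :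
      Set (ρB.pieceQuot O₁)) = (ρB.pieceMk O₁).base '' (O₁.1.ι.base ⁻¹' T₁) := by
    rw [Closeds.coe_preimage, hZcoe, Set.preimage_union,
      preimage_gluedι_eq_empty_of_disjoint ρB O₁ _ (hZ₀ ▸ hZ₀₁),
      preimage_gluedι_image_gluedMk_eq ρB hcov O₁ T₁ h₁₁, Set.empty_union]
  -- the blow-ups of the charts along the pulled-back centre are regular
  have hP₀' : ∃ (B : Scheme.{0}) (pB : B ⟶ ρB.pieceQuot O₀),
      IsBlowup pB ((Scheme.IdealSheafData.vanishingIdeal Z).comap (ρB.gluedι O₀)) ∧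
        Scheme.IsRegular B := by
    rw [comap_vanishingIdeal_of_isOpenImmersion]
    exact hP₀ _ hZpre₀
  have hP₁' : ∃ (B : Scheme.{0}) (pB : B ⟶ ρB.pieceQuot O₁),
      IsBlowup pB ((Scheme.IdealSheafData.vanishingIdeal Z).comap (ρB.gluedι O₁)) ∧
        Scheme.IsRegular B := by
    rw [comap_vanishingIdeal_of_isOpenImmersion]
    exact hP₁ _ hZpre₁
  -- the exit downstairs, transported along `Y → X₁`
  have hres : Scheme.HasResolution ρB.glued :=
    BlowupExit.hasResolution_glued_of_three_pieces ρB hcov O₀ O₁ O₂ hcov₃ Z hZ hZ₂ hQ hP₀' hP₁'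
  exact QuotientModel.hasResolution_of_hasResolution_glued k X' X₁ f q G ρ hfaith hdim hsurj hU
    horb V π hbir ρB hequiv hcov hres

end Summit.ResolutionOfSingularities.ResolutionOfSingularities.Theorems.WildQuotientResolution.ToricExit

end
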